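import Summits.HodgeConjecture.CorCM.CMWeilSectionDichotomy
import Summits.HodgeConjecture.CorCM.CMWeilSectionEndomorphism
import Summits.HodgeConjecture.CorCM.AndreRiemannBiproducts
import Literature.AlgebraicGeometry.HodgeTheory.AbelianLowDimensionWeilReductionProofs
import Literature.AlgebraicGeometry.HodgeTheory.LefschetzOneOneHolds
import HarnessLib

/-!
# Products of CM abelian varieties of total dimension `4`: the Hodge conjecture from Markman's theorem

Cell `pub-hodgecm2` (COR-CM), count-neutral sub-row A3-CM45-products, file 3.  HONEST FRAMING: a CONDITIONAL result —
the Hodge conjecture for products `⨁_i A_i` of CM abelian varieties of total dimension `4`, conditional ONLY on the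
named fact `HodgeTheory.Markman2025_weilClasses_algebraic_abelianFourfold` (Markman 2025: the Weil classes of abelian
fourfolds of Weil type are algebraic; B2b ladder floor R1).  `HC_CM` is never asserted.  This is the CM-product slice
of the named facts `MoonenZarhin1999_codimTwoHodgeClasses_abelianFourfold` (Moonen–Zarhin 1999 Thm. 0.1, ring-2 `h01`)
and `Markman2025_hodgeClasses_algebraic_abelian_dim_le_five` (R2), PROVED here — by Pohlmann's theorem for CM
algebras (`Pohlmann1968_thm1_cmAlgebra`) and the elementary dichotomy
`CMWeights.mem_pohlmannDivisorSetsAlg_two_or_weilSection` instead of Moonen–Zarhin's Mumford–Tate analysis.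

Setting: realisations `(A_i, ι_i, θ_i)` of CM types `Φ_i` of CM fields `K_i` on `H¹`
(`ComplexMultiplication.IsCMTypeRealisation`; any finite family, any fields, repetitions allowed),
`B = ⨁_i A_i` with `dim B = 4`.

* `weightClassesAlg_le_algebraicClasses_of_mem_pohlmannDivisorSetsAlg` — a weight indexing a divisor monomial is
  algebraic (`divisorClassesSpan_biproduct_eq_iSup` + Lefschetz `(1,1)` `lefschetzOneOne_rational_holds` + cup products
  on abelian varieties, `AbelianVariety.divisorClassesSpan_le_algebraicClasses`) — any dimension;
* `isWeilType_of_weilSection`, `weightClassesAlg_le_algebraicClasses_of_weilSection` — a Weil section `S` of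
  `B` (total dimension `2m`) makes `(B, φ_S)` a pair of WEIL TYPE `(m, d)` (`exists_sqrt_neg_of_weilSection`,
  `weightClassesAlg_le_weilClassesPlus_of_weilSection`, Deligne–Milne Prop. 4.4), and its weight line is algebraic
  as soon as the rational `(m,m)` classes of the Weil plane of `(B, φ_S)` are;
* **`mem_algebraicClasses_two_biproduct_of_markman`** — `dim B = 4`: every rational `(2,2)` class on `B` is
  algebraic, granted Markman's fact;
* **`moonenZarhin_codimTwo_biproduct_cm`** — `dim B = 4`: the CONCLUSION of
  `MoonenZarhin1999_codimTwoHodgeClasses_abelianFourfold` at `B` («`B²(X) ⊆ D²(X) + Σ W_k`»), hypothesis-free;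
* **`hodgeConjectureFor_biproduct_dim_four_of_markman`** — `dim B = 4`: `HodgeConjectureFor 4 B.X` granted
  Markman's fact (codimension `0`, Lefschetz `(1,1)`, the codimension-`2` theorem, and hard Lefschetz
  `nonempty_hardLefschetzNFold_holds` for codimensions `3, 4`).

Consumer: `CorCM/CMFourfoldsOfMarkman` (every complex abelian variety of CM type of dimension `≤ 4`).

## References

* [MoonenZarhin1999LowDim] B. Moonen, Yu. Zarhin, Math. Ann. 315 (1999) 711–733, Thm. 0.1, (1.4), (1.9).
* [Markman2025SurveySecant] E. Markman, arXiv:2509.23403, Thm. 1.2, §1.1 and Cor. 1.3.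
* [vanGeemen1994HodgeAV] B. van Geemen, LNM 1594, §2.4, 4.9–4.10, Lemma 5.2, Thm. 6.12.
* [Deligne1982HodgeCycles] P. Deligne, LNM 900, §4 Prop. 4.4.
* [GaoUllmo2025] Z. Gao, E. Ullmo, J. Inst. Math. Jussieu 25 (2025), Thm. 3.1.
-/

noncomputable section

open CategoryTheory CategoryTheory.Limits NumberField

namespace Summit.HodgeConjecture.CorCM.CMWeights

open Literature.AlgebraicGeometry.Motives (AbelianVariety CMType IsSmoothProjective ComplexPoints)
open Literature.AlgebraicGeometry.HodgeTheory
open Literature.AlgebraicGeometry.Pohlmann1968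
open Literature.AlgebraicGeometry.ComplexMultiplication (IsCMTypeRealisation)
open Literature.AlgebraicTopology.SingularHomology
open Literature.NumberTheory.ComplexMultiplication
open Literature.Barriers.HodgeConjecture (divisorClassesSpan)

open scoped Classical Pointwise

variable {n : ℕ} {K : Fin n → Type} [∀ i, Field (K i)] [∀ i, NumberField (K i)] [∀ i, IsCMField (K i)]
variable {A : Fin n → AbelianVariety ℂ} {Φ : ∀ i, CMType (K i)} {ι : ∀ i, 𝓞 (K i) →+* End (A i)}
  {θ : ∀ i, K i →+* Module.End ℂ (complexBetti (A i).X 1)}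

/-! ### §1 Divisor weights are algebraic -/

omit [∀ i, IsCMField (K i)] in
/-- **A weight indexing a divisor monomial is algebraic**: for `S ∈ pohlmannDivisorSetsAlg Φ m` the weight line
`H^{2m}(B)_S` lies in `Dᵐ(B) ⊗ ℂ` (`divisorClassesSpan_biproduct_eq_iSup`), which lies in `Nᵐ H^{2m}` by
Lefschetz `(1,1)` (`lefschetzOneOne_rational_holds`) and the algebraicity of cup products with divisor classes on
abelian varieties (`AbelianVariety.divisorClassesSpan_le_algebraicClasses`): «if `Dᵖ = Bᵖ` the Hodge
`(p,p)`-conjecture holds» (van Geemen §2.4). [cite: vanGeemen1994HodgeAV, §2.4] -/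
theorem weightClassesAlg_le_algebraicClasses_of_mem_pohlmannDivisorSetsAlg
    (hA : ∀ i, IsCMTypeRealisation (Φ i) (A i) (ι i) (θ i)) {m : ℕ}
    {S : Finset ((i : Fin n) × (K i →+* ℂ))} (hS : S ∈ pohlmannDivisorSetsAlg Φ m) :
    weightClassesAlg A ι (2 * m) S ≤ algebraicClasses (⨁ A).X m := by
  have hX : IsSmoothProjective (⨁ A).dim (⨁ A).X := AbelianVariety.isSmoothProjective_holds
  refine le_trans ?_ (AbelianVariety.divisorClassesSpan_le_algebraicClasses (⨁ A)
    (fun b hb hbb => lefschetzOneOne_rational_holds hX b hb hbb) m)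
  rw [divisorClassesSpan_biproduct_eq_iSup hA m]
  exact le_iSup₂_of_le S hS le_rfl

/-! ### §2 Weil sections give pairs of Weil type -/

omit [∀ i, IsCMField (K i)] in
/-- `Σ_i [K_i : ℚ] = 2 · dim (⨁_i A_i)` for a family of realisations (`dim_ℂ H¹(A_i) = [K_i:ℚ] = 2 dim A_i`).
[folklore] -/
theorem sum_finrank_eq_two_mul_dim (hA : ∀ i, IsCMTypeRealisation (Φ i) (A i) (ι i) (θ i)) :
    ∑ i, Module.finrank ℚ (K i) = 2 * (⨁ A).dim := by
  rw [AndreRiemann.dim_biproduct_fin, Finset.mul_sum]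
  refine Finset.sum_congr rfl fun i _ => ?_
  rw [← (hA i).2.1, AbelianVariety.finrank_complexBetti_one]

omit [∀ i, IsCMField (K i)] in
/-- **A Weil section makes `(B, φ_S)` a pair of Weil type.**  For realisations of total dimension `2m` (`m ≥ 1`)
and a Weil section `S ∈ pohlmannSetsAlg Φ m`, with the `d ≥ 1`, `a_i ∈ 𝓞_{K_i}` (`a_i² = -d`) of
`weightClassesAlg_le_weilClassesPlus_of_weilSection`: `φ_S = ⊕_i ι_i(a_i)` has `φ_S² = -d`, the weight line
`H^{2m}(B)_S` lies in the Weil plane `weilClassesOf B φ_S m d`, and `(B, φ_S)` is of Weil type `(m, d)` — the plane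
contains the NON-ZERO `(m,m)` class `w_S` (Deligne–Milne Prop. 4.4 (⇒), `isWeilType_of_weilClass_ne_zero`).
[cite: Deligne1982HodgeCycles, §4 Prop. 4.4] [cite: vanGeemen1994HodgeAV, 4.9–4.10] -/
theorem isWeilType_of_weilSection (hA : ∀ i, IsCMTypeRealisation (Φ i) (A i) (ι i) (θ i)) {m : ℕ}
    (hm : 0 < m) (hdim : (⨁ A).dim = 2 * m) {S : Finset ((i : Fin n) × (K i →+* ℂ))}
    (hS : S ∈ pohlmannSetsAlg Φ m) (hsec : ∀ x ∈ S, (starRingAut : ℂ ≃+* ℂ) • x ∉ S)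
    (hfull : ∀ x : (i : Fin n) × (K i →+* ℂ), x ∈ S ∨ (starRingAut : ℂ ≃+* ℂ) • x ∈ S)
    (hW : ∀ τ : ℂ ≃+* ℂ, τ • S = S ∨ τ • S = (starRingAut : ℂ ≃+* ℂ) • S) :
    ∃ (d : ℕ) (a : ∀ i, 𝓞 (K i)), 0 < d ∧
      (biproduct.map fun i => ι i (a i)) ≫ (biproduct.map fun i => ι i (a i)) = -(d • 𝟙 (⨁ A)) ∧
      weightClassesAlg A ι (2 * m) S ≤ weilClassesOf (⨁ A) (biproduct.map fun i => ι i (a i)) m d ∧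
      IsWeilType (⨁ A) (biproduct.map fun i => ι i (a i)) m d := by
  have hS0 : S.Nonempty := by rw [← Finset.card_pos, hS.1]; omega
  obtain ⟨d, a, hd, -, hφ, hle, c, hc, hc0, hcH⟩ :=
    weightClassesAlg_le_weilClassesPlus_of_weilSection hA hS hS0 hsec hfull hW
  have hle' : weightClassesAlg A ι (2 * m) S ≤ weilClassesOf (⨁ A) (biproduct.map fun i => ι i (a i)) m d :=
    hle.trans (weilClassesPlus_le_weilClassesOf _ _ m d)
  refine ⟨d, a, hd, hφ, hle', ?_⟩
  rw [hdim] at hcH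
  exact isWeilType_of_weilClass_ne_zero hm hd hdim hφ (hle' hc) hc0 hcH

omit [∀ i, IsCMField (K i)] in
/-- **The weight line of a Weil section is algebraic as soon as the rational `(m,m)` classes of the Weil plane of
`(B, φ_S)` are** (the plane of a Weil-type pair is spanned by its rational classes, all of type `(m,m)`:
`IsWeilType.weilClassesOf_le_algebraicClasses`, van Geemen 4.9 / Lemma 5.2). [cite: vanGeemen1994HodgeAV, 4.9 and Lemma 5.2] -/
theorem weightClassesAlg_le_algebraicClasses_of_weilSection (hA : ∀ i, IsCMTypeRealisation (Φ i) (A i) (ι i) (θ i))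
    {m : ℕ} (hm : 0 < m) (hdim : (⨁ A).dim = 2 * m) {S : Finset ((i : Fin n) × (K i →+* ℂ))}
    (hS : S ∈ pohlmannSetsAlg Φ m) (hsec : ∀ x ∈ S, (starRingAut : ℂ ≃+* ℂ) • x ∉ S)
    (hfull : ∀ x : (i : Fin n) × (K i →+* ℂ), x ∈ S ∨ (starRingAut : ℂ ≃+* ℂ) • x ∈ S)
    (hW : ∀ τ : ℂ ≃+* ℂ, τ • S = S ∨ τ • S = (starRingAut : ℂ ≃+* ℂ) • S)
    (halg : ∀ (d : ℕ) (φ : (⨁ A) ⟶ (⨁ A)), 0 < d → φ ≫ φ = -(d • 𝟙 (⨁ A)) →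
      ∀ c ∈ weilClassesOf (⨁ A) φ m d, IsRationalClass c → IsOfHodgeType (2 * m) (⨁ A).X (2 * m) m m c →
        c ∈ algebraicClasses (⨁ A).X m) :
    weightClassesAlg A ι (2 * m) S ≤ algebraicClasses (⨁ A).X m := by
  obtain ⟨d, a, hd, hφ, hle, hWT⟩ := isWeilType_of_weilSection hA hm hdim hS hsec hfull hW
  exact hle.trans (hWT.weilClassesOf_le_algebraicClasses (halg d _ hd hφ))

/-! ### §3 Total dimension `4`: every rational `(2,2)` class is algebraic, granted Markman's theorem -/

/-- **Every weight of `B² ⊗ ℂ` of a CM-product fourfold is algebraic, granted Markman's theorem.**  For realisations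
of total dimension `4` and `S ∈ pohlmannSetsAlg Φ 2`: either `S` indexes a divisor monomial (§1) or `S` is a Weil
section (`CMWeights.mem_pohlmannDivisorSetsAlg_two_or_weilSection`), and then its line lies in the Weil plane of the
Weil-type pair `(B, φ_S)`, whose rational `(2,2)` classes are algebraic by
`Markman2025_weilClasses_algebraic_abelianFourfold`. [cite: Markman2025SurveySecant, Thm. 1.2 and §1.1]
[cite: MoonenZarhin1999LowDim, Thm. 0.1] -/
theorem weightClassesAlg_le_algebraicClasses_two_of_markman (hW4 : Markman2025_weilClasses_algebraic_abelianFourfold)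
    (hA : ∀ i, IsCMTypeRealisation (Φ i) (A i) (ι i) (θ i)) (h4 : (⨁ A).dim = 4)
    {S : Finset ((i : Fin n) × (K i →+* ℂ))} (hS : S ∈ pohlmannSetsAlg Φ 2) :
    weightClassesAlg A ι (2 * 2) S ≤ algebraicClasses (⨁ A).X 2 := by
  have h8 : ∑ i, Module.finrank ℚ (K i) = 8 := by rw [sum_finrank_eq_two_mul_dim hA, h4]
  rcases mem_pohlmannDivisorSetsAlg_two_or_weilSection h8 Φ hS with hD | ⟨hsec, hfull, hW⟩
  · exact weightClassesAlg_le_algebraicClasses_of_mem_pohlmannDivisorSetsAlg hA hD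
  · have hdim : (⨁ A).dim = 2 * 2 := h4
    refine weightClassesAlg_le_algebraicClasses_of_weilSection hA (by norm_num) hdim hS hsec hfull hW ?_
    intro d φ hd hφ c hcW hcQ hcH
    have hX : IsSmoothProjective (2 * 2) (⨁ A).X := by
      rw [← hdim]; exact AbelianVariety.isSmoothProjective_holds
    exact hW4 d hd (⨁ A) φ hdim hX hφ c hcQ hcH hcW

/-- **Codimension `2` on a CM-product fourfold, granted Markman's theorem**: every rational class of Hodge type
`(2,2)` on `B = ⨁_i A_i` (`dim B = 4`, `A_i` realising CM types of CM fields `K_i`) is algebraic — Pohlmann's theorem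
for CM algebras puts it in `⊕_S H⁴(B)_S` over the balanced `4`-subsets `S` (`mem_iSup_weightClassesAlg`), each of
which is algebraic (`weightClassesAlg_le_algebraicClasses_two_of_markman`).  The CM-product slice of the fact
`Markman2025_hodgeClasses_algebraic_abelian_dim_le_five` in codimension `2`, with NO Moonen–Zarhin input.
[cite: Markman2025SurveySecant, §1.1 and Cor. 1.3] [cite: GaoUllmo2025, Thm. 3.1] -/
theorem mem_algebraicClasses_two_biproduct_of_markman (hW4 : Markman2025_weilClasses_algebraic_abelianFourfold)
    (hA : ∀ i, IsCMTypeRealisation (Φ i) (A i) (ι i) (θ i)) (h4 : (⨁ A).dim = 4)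
    (c : complexBetti (⨁ A).X (2 * 2)) (hcQ : IsRationalClass c) (hcH : IsOfHodgeType (⨁ A).dim (⨁ A).X (2 * 2) 2 2 c) :
    c ∈ algebraicClasses (⨁ A).X 2 := by
  have hle : (⨆ S ∈ pohlmannSetsAlg Φ 2, weightClassesAlg A ι (2 * 2) S) ≤ algebraicClasses (⨁ A).X 2 :=
    iSup₂_le fun S hS => weightClassesAlg_le_algebraicClasses_two_of_markman hW4 hA h4 hS
  exact hle (mem_iSup_weightClassesAlg hA hcQ hcH)

/-! ### §4 The conclusion of Moonen–Zarhin's Thm. 0.1 at a CM-product fourfold, hypothesis-free -/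

/-- **`B²(B) ⊗ ℂ ⊆ (D²(B) ⊗ ℂ) + span_ℂ {rational (2,2) Weil classes}` for a CM-product fourfold** — the CONCLUSION of
the named fact `MoonenZarhin1999_codimTwoHodgeClasses_abelianFourfold` (Moonen–Zarhin 1999 Thm. 0.1 with (1.4),
(1.9): «`B²(X) = D²(X) + Σ W_k`») at `B = ⨁_i A_i`, `dim B = 4`, PROVED: a divisor weight lies in `D² ⊗ ℂ`; a Weil
section's line lies in the Weil plane of the Weil-type pair `(B, φ_S)`, which is the complex span of its rational
classes (`weilClassesOf_eq_span_isRationalClass`), all of type `(2,2)` (`IsWeilType.isOfHodgeType_of_mem_weilClassesOf`).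
[cite: MoonenZarhin1999LowDim, Thm. 0.1 with (1.4) and (1.9)] [cite: vanGeemen1994HodgeAV, 4.9 and Lemma 5.2] -/
theorem moonenZarhin_codimTwo_biproduct_cm (hA : ∀ i, IsCMTypeRealisation (Φ i) (A i) (ι i) (θ i))
    (h4 : (⨁ A).dim = 4) (c : complexBetti (⨁ A).X (2 * 2)) (hcQ : IsRationalClass c)
    (hcH : IsOfHodgeType (⨁ A).dim (⨁ A).X (2 * 2) 2 2 c) :
    c ∈ divisorClassesSpan (⨁ A).X (⨁ A).dim 2 ⊔
      Submodule.span ℂ {w : complexBetti (⨁ A).X (2 * 2) | ∃ (d : ℕ) (φ : (⨁ A) ⟶ (⨁ A)), 0 < d ∧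
        φ ≫ φ = -(d • 𝟙 (⨁ A)) ∧ IsRationalClass w ∧ IsOfHodgeType (⨁ A).dim (⨁ A).X (2 * 2) 2 2 w ∧
        w ∈ weilClassesOf (⨁ A) φ 2 d} := by
  have h8 : ∑ i, Module.finrank ℚ (K i) = 8 := by rw [sum_finrank_eq_two_mul_dim hA, h4]
  have hdim : (⨁ A).dim = 2 * 2 := h4
  refine (iSup₂_le fun S hS => ?_ :
    (⨆ S ∈ pohlmannSetsAlg Φ 2, weightClassesAlg A ι (2 * 2) S) ≤ _) (mem_iSup_weightClassesAlg hA hcQ hcH)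
  rcases mem_pohlmannDivisorSetsAlg_two_or_weilSection h8 Φ hS with hD | ⟨hsec, hfull, hW⟩
  · refine le_trans ?_ le_sup_left
    rw [divisorClassesSpan_biproduct_eq_iSup hA 2]
    exact le_iSup₂_of_le S hD le_rfl
  · obtain ⟨d, a, hd, hφ, hle, hWT⟩ := isWeilType_of_weilSection hA (by norm_num) hdim hS hsec hfull hW
    refine le_trans hle (le_trans ?_ le_sup_right)
    rw [weilClassesOf_eq_span_isRationalClass (by norm_num) hdim hd hφ]
    refine Submodule.span_mono ?_
    rintro w ⟨hwQ, hwW⟩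
    refine ⟨d, _, hd, hφ, hwQ, ?_, hwW⟩
    rw [hdim]
    exact hWT.isOfHodgeType_of_mem_weilClassesOf hwW

/-! ### §5 The Hodge conjecture for CM-product fourfolds, granted Markman's theorem -/

/-- **The Hodge conjecture for a product of CM abelian varieties of total dimension `4`, granted Markman's theorem on
the Weil classes of abelian fourfolds.**  For realisations `(A_i, ι_i, θ_i)` of CM types of CM fields `K_i` with
`dim ⨁_i A_i = 4`: `HodgeConjectureFor 4 (⨁ A).X` — codimension `0` (`hodgeConjectureFor_codim_zero`), `1` (Lefschetz
`(1,1)`, `lefschetzOneOne_rational_holds`), `2` (`mem_algebraicClasses_two_biproduct_of_markman`), and `3, 4` by hard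
Lefschetz (`nonempty_hardLefschetzNFold_holds`, `mem_algebraicClasses_of_lt_of_nonempty`).  The CM-product slice of
the fact `Markman2025_hodgeClasses_algebraic_abelian_dim_le_five` at dimension `4`, with the two Moonen–Zarhin facts
of its printed proof replaced by Pohlmann's theorem and `mem_pohlmannDivisorSetsAlg_two_or_weilSection`.
[cite: Markman2025SurveySecant, §1.1 and Cor. 1.3] [cite: MoonenZarhin1999LowDim, Thm. 0.1]
[cite: VoisinHodgeI2002, Thm. 6.25 and Thm. 11.30] -/
theorem hodgeConjectureFor_biproduct_dim_four_of_markman (hW4 : Markman2025_weilClasses_algebraic_abelianFourfold)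
    (hA : ∀ i, IsCMTypeRealisation (Φ i) (A i) (ι i) (θ i)) (h4 : (⨁ A).dim = 4) :
    HodgeConjectureFor 4 (⨁ A).X := by
  have hX : IsSmoothProjective (⨁ A).dim (⨁ A).X := AbelianVariety.isSmoothProjective_holds
  rw [← h4]
  refine ⟨nonempty_hodgeModel_holds hX, fun p c hc hpp => ?_⟩
  -- the half `2q ≤ dim`: codimension zero, Lefschetz `(1,1)`, and the codimension-`2` theorem
  have low : ∀ (q : ℕ) (c : complexBetti (⨁ A).X (2 * q)), 2 * q ≤ (⨁ A).dim → IsRationalClass c →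
      IsOfHodgeType (⨁ A).dim (⨁ A).X (2 * q) q q c → c ∈ algebraicClasses (⨁ A).X q := by
    intro q c hq hc hqq
    have hq2 : q ≤ 2 := by omega
    interval_cases q
    · exact hodgeConjectureFor_codim_zero c
    · exact lefschetzOneOne_rational_holds hX c hc hqq
    · exact mem_algebraicClasses_two_biproduct_of_markman hW4 hA h4 c hc hqq
  rcases Nat.lt_or_ge (⨁ A).dim (2 * p) with hlt | hge
  · exact mem_algebraicClasses_of_lt_of_nonempty (nonempty_hardLefschetzNFold_holds _ _) hX hlt
      (fun c' hc' hpp' ↦ low ((⨁ A).dim - p) c' (by omega) hc' hpp') c hc hpp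
  · exact low p c hge hc hpp

/-- The same with the dimension parameter `(⨁ A).dim` (the shape `HodgeConjectureFor A.dim A.X` of the tree's
abelian-variety statements). [cite: Markman2025SurveySecant, §1.1 and Cor. 1.3] -/
theorem hodgeConjectureFor_biproduct_dim_four_of_markman' (hW4 : Markman2025_weilClasses_algebraic_abelianFourfold)
    (hA : ∀ i, IsCMTypeRealisation (Φ i) (A i) (ι i) (θ i)) (h4 : (⨁ A).dim = 4) :
    HodgeConjectureFor (⨁ A).dim (⨁ A).X := by
  rw [h4]
  exact hodgeConjectureFor_biproduct_dim_four_of_markman hW4 hA h4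

end Summit.HodgeConjecture.CorCM.CMWeights

end
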